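import Literature.MathematicalPhysics.QuantumLattice.TorusOutwardNeighbours
import Literature.MathematicalPhysics.QuantumLattice.LatticeToriProofs
import Mathlib.NumberTheory.Harmonic.Bounds
import Mathlib.Analysis.SpecialFunctions.Trigonometric.DerivHyp
import HarnessLib

/-!
# The truncated logarithmic dipole potential on the discrete torus `(ℤ/Lℤ)²`

Trunk T-QLATTICE (family `hubbard`; consumer: the sharp-exponent Koma–Tasaki bound of
`Summits/HubbardSuperconductivity/HubbardLadder/Bounds/PairCorrelationEtaLineDipole.lean`).

Koma–Tasaki (PRL 68 (1992) 3248, proof of eq. (13), following McBryan–Spencer, CMP 53 (1977) 299)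
optimise their complex-gauge bound with a DIPOLE potential `φ` solving a lattice Poisson equation
with charges `±q` at `x` and `y`, whose two properties are P1: `φ_x - φ_y ≈ (q/π) log|x - y|`
(gain) and P2: `Σ_{bonds} |∇φ|² ≈ (q²/π) log|x - y|` (energy). The tree's radial test potential
`exists_torusTestPotential` (`TorusTestPotential.lean`) is a MONOPOLE truncated at the full
distance, with gain `q H(D)` against energy `≤ 128 q² H(D)` (crude counting). This file builds the
`ℓ^∞` dipole explicitly and counts sharply:

* `logMonopole_energy_le` — the truncated logarithmic monopole `φ^{(y)}(u) = q H(min(dist(u,y), ρ))`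
  (`H` = harmonic numbers, `dist` = periodic `ℓ^∞` distance) has
  `Σ_u Σ_v [u∼v] (cosh(φ_u - φ_v) - 1) ≤ 8 q² e^{q²/2} H(ρ)` for every `q` and `ρ`, uniformly in
  `L` (sharp shell-crossing count `≤ 8s+4` of `TorusOutwardNeighbours.sum_card_outward_le`, and
  `cosh s - 1 ≤ (s²/2)e^{s²/2}`);
* `exists_logDipole` — for `2ρ + 1 ≤ dist(x,y)` the dipole `φ^{(y)} - φ^{(x)}` has gain
  `φ_x - φ_y = 2q H(ρ)` and energy `≤ 16 q² e^{q²/2} H(ρ)` (the two monopoles vary on disjoint sets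
  of bonds, so the energies add).

The gain/energy ratio `(8q e^{q²/2})⁻¹` (as `q → 0`: `1/(8q)`) is four times that of the radial
monopole with sharp counting and sixteen times the tree's `1/(128 q)`·`2q` bookkeeping; it is what
moves the machine-checked Koma–Tasaki `η`-line from `T > 32|t|` to `T ≳ 2|t|` (tree hopping norm)
and `T ≳ |t|` (sharp hopping norm). The Euclidean (`ℓ²`) dipole of the paper, with `2π` in place
of `8`, needs lattice potential theory not in Mathlib and is NOT formalised.

Sources: T. Koma, H. Tasaki, PRL 68 (1992) 3248, proof of eq. (13); O. A. McBryan, T. Spencer,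
Commun. Math. Phys. 53 (1977) 299.

## Mathlib search

`harmonic`, `harmonic_succ`, `Real.cosh_le_exp_half_sq`, `Real.add_one_le_exp`,
`Finset.sum_fiberwise_of_maps_to`, `Fintype.sum_equiv`, `Equiv.subRight`; torus geometry from the
tree (`min_torusDist_lipschitz`, `torusDist_le_of_adj`, `torusDist_triangle'`, `torusDist_comm'`,
`sum_card_outward_le`, `torusGraph_adj_sub_right_iff`). No Mathlib discrete potential theory.
-/

noncomputable section

namespace Literature.MathematicalPhysics.QuantumLattice

open Finset Literature.Probability.LatticeModels

/-! ### Two elementary inequalities -/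

/-- `cosh s - 1 ≤ (s²/2) e^{s²/2}` (from `cosh s ≤ e^{s²/2}` and `e^u - 1 ≤ u e^u`). [folklore] -/
private theorem cosh_sub_one_le_half_sq_mul_exp (s : ℝ) :
    Real.cosh s - 1 ≤ s ^ 2 / 2 * Real.exp (s ^ 2 / 2) := by
  have h1 : Real.cosh s ≤ Real.exp (s ^ 2 / 2) := Real.cosh_le_exp_half_sq s
  have h2 : 1 - s ^ 2 / 2 ≤ Real.exp (-(s ^ 2 / 2)) := by
    have := Real.add_one_le_exp (-(s ^ 2 / 2)); linarith
  have h3 : Real.exp (s ^ 2 / 2) * (1 - s ^ 2 / 2) ≤ 1 := by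
    have := mul_le_mul_of_nonneg_left h2 (Real.exp_pos (s ^ 2 / 2)).le
    rwa [← Real.exp_add, add_neg_cancel, Real.exp_zero] at this
  have h4 : Real.exp (s ^ 2 / 2) * (1 - s ^ 2 / 2) =
      Real.exp (s ^ 2 / 2) - s ^ 2 / 2 * Real.exp (s ^ 2 / 2) := by ring
  linarith

/-- The shell weight of the logarithmic potential:
`(8s+4)(cosh(q/(s+1)) - 1) ≤ 4 q² e^{q²/2}/(s+1)`. [folklore] -/
private theorem shell_weight_le (q : ℝ) (s : ℕ) :
    (8 * (s : ℝ) + 4) * (Real.cosh (q * ((s : ℝ) + 1)⁻¹) - 1) ≤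
      4 * (q ^ 2 * Real.exp (q ^ 2 / 2)) * ((s : ℝ) + 1)⁻¹ := by
  have hs : (0 : ℝ) < (s : ℝ) + 1 := by positivity
  have hr2eq : (q * ((s : ℝ) + 1)⁻¹) ^ 2 = q ^ 2 * (((s : ℝ) + 1) ^ 2)⁻¹ := by
    rw [mul_pow, inv_pow]
  have hr2 : (q * ((s : ℝ) + 1)⁻¹) ^ 2 ≤ q ^ 2 := by
    rw [hr2eq]
    calc q ^ 2 * (((s : ℝ) + 1) ^ 2)⁻¹ ≤ q ^ 2 * 1 := by
          refine mul_le_mul_of_nonneg_left ?_ (sq_nonneg q)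
          rw [inv_le_one_iff₀]
          right
          nlinarith [show (0 : ℝ) ≤ (s : ℝ) from Nat.cast_nonneg s]
      _ = q ^ 2 := mul_one _
  have he : Real.cosh (q * ((s : ℝ) + 1)⁻¹) - 1 ≤
      (q * ((s : ℝ) + 1)⁻¹) ^ 2 / 2 * Real.exp (q ^ 2 / 2) :=
    (cosh_sub_one_le_half_sq_mul_exp _).trans
      (mul_le_mul_of_nonneg_left (Real.exp_le_exp.2 (by linarith)) (by positivity))
  have h84 : (8 * (s : ℝ) + 4) ≤ 8 * ((s : ℝ) + 1) := by linarith
  calc (8 * (s : ℝ) + 4) * (Real.cosh (q * ((s : ℝ) + 1)⁻¹) - 1)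
      ≤ (8 * ((s : ℝ) + 1)) * ((q * ((s : ℝ) + 1)⁻¹) ^ 2 / 2 * Real.exp (q ^ 2 / 2)) :=
        mul_le_mul h84 he (sub_nonneg.2 (Real.one_le_cosh _)) (by positivity)
    _ = 4 * (q ^ 2 * Real.exp (q ^ 2 / 2)) * ((s : ℝ) + 1)⁻¹ := by
        rw [hr2eq]
        field_simp
        ring

/-- `Σ_{s<ρ} 1/(s+1) = H(ρ)` over `ℝ`. [folklore] -/
private theorem sum_range_inv_eq_harmonic (ρ : ℕ) :
    ∑ s ∈ Finset.range ρ, ((s : ℝ) + 1)⁻¹ = (harmonic ρ : ℝ) := by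
  induction ρ with
  | zero => simp
  | succ n ih =>
      rw [Finset.sum_range_succ, ih, harmonic_succ]
      push_cast
      ring

/-! ### The truncated logarithmic monopole `φ^{(y)}(u) = q H(min(dist(u,y), ρ))` -/

/-- **Energy of the truncated logarithmic monopole.** On `(ℤ/Lℤ)²`, for every centre `y`,
radius `ρ` and charge `q`, the potential `φ(u) = q H(min(dist(u,y), ρ))` (`H` = harmonic numbers)
has `Σ_u Σ_v [u∼v] (cosh(φ_u - φ_v) - 1) ≤ 8 q² e^{q²/2} H(ρ)`, uniformly in `L`: its differences
are `± q/(s+1)` exactly on the `≤ 8s+4` bonds between the shells `dist = s` and `dist = s+1`,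
`s < ρ`, and `(8s+4)(cosh(q/(s+1)) - 1) ≤ 4q²e^{q²/2}/(s+1)`. Koma–Tasaki, PRL 68 (1992) 3248,
proof of eq. (13), properties P1–P2 (`ℓ^∞` version; McBryan–Spencer 1977).
[cite: KomaTasakiPRL1992, proof of eq. (13) (P1–P2)] -/
theorem logMonopole_energy_le (L : ℕ) [NeZero L] (y : TorusSite 2 L) (ρ : ℕ) (q : ℝ) :
    ∑ u : TorusSite 2 L, ∑ v : TorusSite 2 L,
        (if (torusGraph 2 L).Adj u v then
          (Real.cosh (q * (harmonic (min (torusDist u y) ρ) : ℝ) -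
              q * (harmonic (min (torusDist v y) ρ) : ℝ)) - 1)
        else 0) ≤ 8 * (q ^ 2 * Real.exp (q ^ 2 / 2)) * (harmonic ρ : ℝ) := by
  classical
  -- shell weights and the directed (outward) bond weight
  set e : ℕ → ℝ := fun m => Real.cosh (q * ((m : ℝ) + 1)⁻¹) - 1 with he
  have he0 : ∀ m, 0 ≤ e m := fun m => sub_nonneg.2 (Real.one_le_cosh _)
  set g : TorusSite 2 L → TorusSite 2 L → ℝ := fun u v =>
    if min (torusDist v y) ρ = min (torusDist u y) ρ + 1 then e (min (torusDist u y) ρ) else 0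
    with hg
  have hg0 : ∀ u v, 0 ≤ g u v := fun u v => by
    simp only [hg]
    split_ifs
    · exact he0 _
    · exact le_rfl
  have hharm : ∀ m : ℕ, (harmonic (m + 1) : ℝ) - (harmonic m : ℝ) = ((m : ℝ) + 1)⁻¹ := by
    intro m
    rw [harmonic_succ]
    push_cast
    ring
  -- (1) along a bond the `cosh - 1` term is the outward weight in one of the two directions
  have hedge : ∀ u v, (torusGraph 2 L).Adj u v →
      Real.cosh (q * (harmonic (min (torusDist u y) ρ) : ℝ) -
          q * (harmonic (min (torusDist v y) ρ) : ℝ)) - 1 = g u v + g v u := by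
    intro u v huv
    have hlip := min_torusDist_lipschitz y ρ huv
    rcases Nat.lt_trichotomy (min (torusDist u y) ρ) (min (torusDist v y) ρ) with h | h | h
    · have h' : min (torusDist v y) ρ = min (torusDist u y) ρ + 1 := by omega
      have hne : ¬ min (torusDist u y) ρ = min (torusDist v y) ρ + 1 := by omega
      simp only [hg, if_pos h', if_neg hne, add_zero]
      rw [h', ← mul_sub, show (harmonic (min (torusDist u y) ρ) : ℝ) -
          (harmonic (min (torusDist u y) ρ + 1) : ℝ) = -(((min (torusDist u y) ρ : ℕ) : ℝ) + 1)⁻¹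
        by rw [← hharm]; ring, mul_neg, Real.cosh_neg]
    · have h1 : ¬ min (torusDist v y) ρ = min (torusDist u y) ρ + 1 := by omega
      have h2 : ¬ min (torusDist u y) ρ = min (torusDist v y) ρ + 1 := by omega
      simp only [hg, if_neg h1, if_neg h2, add_zero]
      rw [h, sub_self, Real.cosh_zero, sub_self]
    · have h' : min (torusDist u y) ρ = min (torusDist v y) ρ + 1 := by omega
      have hne : ¬ min (torusDist v y) ρ = min (torusDist u y) ρ + 1 := by omega
      simp only [hg, if_pos h', if_neg hne, zero_add]
      rw [h', ← mul_sub, hharm]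
  -- (2) symmetrise
  have hsum : (∑ u : TorusSite 2 L, ∑ v : TorusSite 2 L,
      (if (torusGraph 2 L).Adj u v then
        (Real.cosh (q * (harmonic (min (torusDist u y) ρ) : ℝ) -
            q * (harmonic (min (torusDist v y) ρ) : ℝ)) - 1)
      else 0)) =
      2 * ∑ u : TorusSite 2 L, ∑ v : TorusSite 2 L,
        (if (torusGraph 2 L).Adj u v then g u v else 0) := by
    have hsplit : ∀ u v : TorusSite 2 L,
        (if (torusGraph 2 L).Adj u v then
          (Real.cosh (q * (harmonic (min (torusDist u y) ρ) : ℝ) -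
              q * (harmonic (min (torusDist v y) ρ) : ℝ)) - 1)
        else 0) =
        (if (torusGraph 2 L).Adj u v then g u v else 0) +
          (if (torusGraph 2 L).Adj v u then g v u else 0) := by
      intro u v
      by_cases huv : (torusGraph 2 L).Adj u v
      · rw [if_pos huv, if_pos huv, if_pos ((torusGraph 2 L).adj_symm huv), hedge u v huv]
      · rw [if_neg huv, if_neg huv, if_neg (fun h => huv ((torusGraph 2 L).adj_symm h)), add_zero]
    simp only [hsplit, sum_add_distrib]
    rw [sum_comm (f := fun u v => if (torusGraph 2 L).Adj v u then g v u else 0), two_mul]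
  rw [hsum]
  -- (3) at each site: outward weight × number of outward bonds, and only for `dist(u,y) < ρ`
  have hinner : ∀ u : TorusSite 2 L,
      ∑ v : TorusSite 2 L, (if (torusGraph 2 L).Adj u v then g u v else 0) ≤
        (if torusDist u y < ρ then e (torusDist u y) else 0) *
          (#{v : TorusSite 2 L | (torusGraph 2 L).Adj u v ∧
              torusDist v y = torusDist u y + 1} : ℝ) := by
    intro u
    by_cases hu : torusDist u y < ρ
    · rw [if_pos hu]
      have hmu : min (torusDist u y) ρ = torusDist u y := min_eq_left hu.le
      calc ∑ v : TorusSite 2 L, (if (torusGraph 2 L).Adj u v then g u v else 0)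
          ≤ ∑ v : TorusSite 2 L, (if (torusGraph 2 L).Adj u v ∧
              torusDist v y = torusDist u y + 1 then e (torusDist u y) else 0) := by
            refine sum_le_sum fun v _ => ?_
            by_cases huv : (torusGraph 2 L).Adj u v
            · rw [if_pos huv]
              simp only [hg]
              by_cases hv : min (torusDist v y) ρ = min (torusDist u y) ρ + 1
              · have hd := torusDist_le_of_adj L huv y
                have hdv : torusDist v y = torusDist u y + 1 := by omega
                rw [if_pos hv, if_pos ⟨huv, hdv⟩, hmu]
              · rw [if_neg hv]
                split_ifs
                · exact he0 _
                · exact le_rfl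
            · rw [if_neg huv, if_neg (fun h => huv h.1)]
        _ = e (torusDist u y) * (#{v : TorusSite 2 L | (torusGraph 2 L).Adj u v ∧
              torusDist v y = torusDist u y + 1} : ℝ) := by
            rw [← sum_filter, sum_const, nsmul_eq_mul, mul_comm]
    · rw [if_neg hu, zero_mul]
      refine le_of_eq (sum_eq_zero fun v _ => ?_)
      split_ifs with huv
      · simp only [hg]
        rw [if_neg]
        have hlip := min_torusDist_lipschitz y ρ huv
        omega
      · rfl
  -- (4) translate to the origin and sum over shells
  have htrans : (∑ u : TorusSite 2 L,
      (if torusDist u y < ρ then e (torusDist u y) else 0) *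
        (#{v : TorusSite 2 L | (torusGraph 2 L).Adj u v ∧
            torusDist v y = torusDist u y + 1} : ℝ)) =
      ∑ z : TorusSite 2 L, (if torusNorm z < ρ then e (torusNorm z) else 0) *
        (#{w : TorusSite 2 L | (torusGraph 2 L).Adj z w ∧ torusNorm w = torusNorm z + 1} : ℝ) := by
    refine Fintype.sum_equiv (Equiv.subRight y) _ _ fun u => ?_
    simp only [Equiv.subRight_apply, torusDist]
    congr 2
    rw [card_filter, card_filter]
    refine Fintype.sum_equiv (Equiv.subRight y) _ _ fun v => ?_
    simp only [Equiv.subRight_apply, torusGraph_adj_sub_right_iff]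
  have hmaps : ∀ z ∈ (univ : Finset (TorusSite 2 L)), torusNorm z ∈ range (L + 1) := by
    intro z _
    rw [mem_range, torusNorm_two_eq_max]
    have h0 : (z 0).val < L := ZMod.val_lt _
    omega
  have hshell : ∀ s ∈ range (L + 1),
      ∑ z ∈ (univ : Finset (TorusSite 2 L)) with torusNorm z = s,
          (if torusNorm z < ρ then e (torusNorm z) else 0) *
            (#{w : TorusSite 2 L | (torusGraph 2 L).Adj z w ∧
                torusNorm w = torusNorm z + 1} : ℝ) ≤
        if s < ρ then 4 * (q ^ 2 * Real.exp (q ^ 2 / 2)) * ((s : ℝ) + 1)⁻¹ else 0 := by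
    intro s _
    have hN : (∑ z ∈ (univ : Finset (TorusSite 2 L)) with torusNorm z = s,
        (#{w : TorusSite 2 L | (torusGraph 2 L).Adj z w ∧ torusNorm w = s + 1} : ℝ)) ≤
        8 * (s : ℝ) + 4 := by
      have := sum_card_outward_le (L := L) s
      exact_mod_cast this
    calc ∑ z ∈ (univ : Finset (TorusSite 2 L)) with torusNorm z = s,
          (if torusNorm z < ρ then e (torusNorm z) else 0) *
            (#{w : TorusSite 2 L | (torusGraph 2 L).Adj z w ∧
                torusNorm w = torusNorm z + 1} : ℝ)
        = ∑ z ∈ (univ : Finset (TorusSite 2 L)) with torusNorm z = s,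
            (if s < ρ then e s else 0) *
              (#{w : TorusSite 2 L | (torusGraph 2 L).Adj z w ∧ torusNorm w = s + 1} : ℝ) := by
          refine sum_congr rfl fun z hz => ?_
          simp only [mem_filter, mem_univ, true_and] at hz
          rw [hz]
      _ = (if s < ρ then e s else 0) *
            ∑ z ∈ (univ : Finset (TorusSite 2 L)) with torusNorm z = s,
              (#{w : TorusSite 2 L | (torusGraph 2 L).Adj z w ∧ torusNorm w = s + 1} : ℝ) := by
          rw [mul_sum]
      _ ≤ if s < ρ then 4 * (q ^ 2 * Real.exp (q ^ 2 / 2)) * ((s : ℝ) + 1)⁻¹ else 0 := by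
          split_ifs with hsρ
          · calc e s * _ ≤ e s * (8 * (s : ℝ) + 4) := mul_le_mul_of_nonneg_left hN (he0 s)
              _ = (8 * (s : ℝ) + 4) * (Real.cosh (q * ((s : ℝ) + 1)⁻¹) - 1) := by
                  rw [mul_comm]
              _ ≤ 4 * (q ^ 2 * Real.exp (q ^ 2 / 2)) * ((s : ℝ) + 1)⁻¹ := shell_weight_le q s
          · rw [zero_mul]
  have hH : ∑ s ∈ range ρ, ((s : ℝ) + 1)⁻¹ = (harmonic ρ : ℝ) := sum_range_inv_eq_harmonic ρ
  calc 2 * ∑ u : TorusSite 2 L, ∑ v : TorusSite 2 L,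
        (if (torusGraph 2 L).Adj u v then g u v else 0)
      ≤ 2 * ∑ u : TorusSite 2 L, (if torusDist u y < ρ then e (torusDist u y) else 0) *
          (#{v : TorusSite 2 L | (torusGraph 2 L).Adj u v ∧
              torusDist v y = torusDist u y + 1} : ℝ) := by
        gcongr with u
        exact hinner u
    _ = 2 * ∑ z : TorusSite 2 L, (if torusNorm z < ρ then e (torusNorm z) else 0) *
          (#{w : TorusSite 2 L | (torusGraph 2 L).Adj z w ∧
              torusNorm w = torusNorm z + 1} : ℝ) := by rw [htrans]
    _ = 2 * ∑ s ∈ range (L + 1), ∑ z ∈ (univ : Finset (TorusSite 2 L)) with torusNorm z = s,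
          (if torusNorm z < ρ then e (torusNorm z) else 0) *
            (#{w : TorusSite 2 L | (torusGraph 2 L).Adj z w ∧
                torusNorm w = torusNorm z + 1} : ℝ) := by
        rw [sum_fiberwise_of_maps_to hmaps]
    _ ≤ 2 * ∑ s ∈ range (L + 1),
          (if s < ρ then 4 * (q ^ 2 * Real.exp (q ^ 2 / 2)) * ((s : ℝ) + 1)⁻¹ else 0) := by
        gcongr with s hs
        exact hshell s hs
    _ = 2 * ∑ s ∈ (range (L + 1)).filter (fun s => s < ρ),
          4 * (q ^ 2 * Real.exp (q ^ 2 / 2)) * ((s : ℝ) + 1)⁻¹ := by rw [sum_filter]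
    _ ≤ 2 * ∑ s ∈ range ρ, 4 * (q ^ 2 * Real.exp (q ^ 2 / 2)) * ((s : ℝ) + 1)⁻¹ := by
        refine mul_le_mul_of_nonneg_left (sum_le_sum_of_subset_of_nonneg (fun s hs => ?_)
          (fun s _ _ => by positivity)) (by norm_num)
        simp only [mem_filter, mem_range] at hs ⊢
        exact hs.2
    _ = 8 * (q ^ 2 * Real.exp (q ^ 2 / 2)) * (harmonic ρ : ℝ) := by
        rw [← mul_sum, hH]
        ring

/-! ### The logarithmic dipole -/

/-- **The truncated logarithmic dipole.** On `(ℤ/Lℤ)²`, for sites `x, y`, a charge `q` and a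
radius `ρ` with `2ρ + 1 ≤ dist(x,y)`, the dipole `φ = φ^{(y)} - φ^{(x)}`,
`φ^{(c)}(u) = q H(min(dist(u,c), ρ))`, has gain `φ_x - φ_y = 2q H(ρ)` and energy
`Σ_u Σ_v [u∼v] (cosh(φ_u - φ_v) - 1) ≤ 16 q² e^{q²/2} H(ρ)`: the two monopoles vary on disjoint
sets of bonds (balls of radius `ρ` about `y` and `x`), so bondwise
`cosh(φ_u - φ_v) - 1 = (cosh ∇φ^{(y)} - 1) + (cosh ∇φ^{(x)} - 1)`. Koma–Tasaki, PRL 68 (1992)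
3248, proof of eq. (13) (the dipole with properties P1 `φ_x - φ_y ≈ (q/π) log|x-y|` and P2
`Σ |∇φ|² ≈ (q²/π) log|x-y|`; here the `ℓ^∞` version with constants `2qH(ρ)` and `16q²e^{q²/2}H(ρ)`
and the two supports separated), following McBryan–Spencer (1977).
[cite: KomaTasakiPRL1992, proof of eq. (13) (P1–P2)] -/
theorem exists_logDipole (L : ℕ) [NeZero L] (x y : TorusSite 2 L) (q : ℝ) (ρ : ℕ)
    (hρ : 2 * ρ + 1 ≤ torusDist x y) :
    ∃ φ : TorusSite 2 L → ℝ, φ x - φ y = 2 * q * (harmonic ρ : ℝ) ∧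
      ∑ u : TorusSite 2 L, ∑ v : TorusSite 2 L,
          (if (torusGraph 2 L).Adj u v then (Real.cosh (φ u - φ v) - 1) else 0) ≤
        16 * (q ^ 2 * Real.exp (q ^ 2 / 2)) * (harmonic ρ : ℝ) := by
  classical
  set A : TorusSite 2 L → ℝ := fun u => q * (harmonic (min (torusDist u y) ρ) : ℝ) with hA
  set B : TorusSite 2 L → ℝ := fun u => q * (harmonic (min (torusDist u x) ρ) : ℝ) with hB
  refine ⟨fun u => A u - B u, ?_, ?_⟩
  · -- gain
    have hxy : min (torusDist x y) ρ = ρ := min_eq_right (by omega)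
    have hyx : min (torusDist y x) ρ = ρ := by rw [torusDist_comm']; exact hxy
    simp only [hA, hB, torusDist_self, hxy, hyx, Nat.zero_min, harmonic_zero, Rat.cast_zero,
      mul_zero]
    ring
  · -- energy: bondwise splitting
    have hsplit : ∀ u v, (torusGraph 2 L).Adj u v →
        Real.cosh ((A u - B u) - (A v - B v)) - 1 =
          (Real.cosh (A u - A v) - 1) + (Real.cosh (B u - B v) - 1) := by
      intro u v huv
      have hre : (A u - B u) - (A v - B v) = (A u - A v) - (B u - B v) := by ring
      rw [hre]
      by_cases hyc : min (torusDist u y) ρ = min (torusDist v y) ρ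
      · have hA0 : A u - A v = 0 := by simp only [hA, hyc, sub_self]
        rw [hA0, zero_sub, Real.cosh_neg, Real.cosh_zero, sub_self, zero_add]
      · -- the bond meets the ball of radius `ρ` about `y`, hence not the one about `x`
        have hlip := min_torusDist_lipschitz y ρ huv
        have hd := torusDist_le_of_adj L huv y
        have huy : torusDist u y ≤ ρ := by omega
        have hvy : torusDist v y ≤ ρ := by omega
        have htu := torusDist_triangle' x u y
        have htv := torusDist_triangle' x v y
        rw [torusDist_comm' x u] at htu
        rw [torusDist_comm' x v] at htv
        have hux : min (torusDist u x) ρ = ρ := min_eq_right (by omega)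
        have hvx : min (torusDist v x) ρ = ρ := min_eq_right (by omega)
        have hB0 : B u - B v = 0 := by simp only [hB, hux, hvx, sub_self]
        rw [hB0, sub_zero, Real.cosh_zero, sub_self, add_zero]
    have hmonoY := logMonopole_energy_le L y ρ q
    have hmonoX := logMonopole_energy_le L x ρ q
    calc ∑ u : TorusSite 2 L, ∑ v : TorusSite 2 L,
          (if (torusGraph 2 L).Adj u v then (Real.cosh ((A u - B u) - (A v - B v)) - 1) else 0)
        = ∑ u : TorusSite 2 L, ∑ v : TorusSite 2 L,
            ((if (torusGraph 2 L).Adj u v then (Real.cosh (A u - A v) - 1) else 0) +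
              (if (torusGraph 2 L).Adj u v then (Real.cosh (B u - B v) - 1) else 0)) := by
          refine sum_congr rfl fun u _ => sum_congr rfl fun v _ => ?_
          split_ifs with huv
          · exact hsplit u v huv
          · simp
      _ = (∑ u : TorusSite 2 L, ∑ v : TorusSite 2 L,
            (if (torusGraph 2 L).Adj u v then (Real.cosh (A u - A v) - 1) else 0)) +
          ∑ u : TorusSite 2 L, ∑ v : TorusSite 2 L,
            (if (torusGraph 2 L).Adj u v then (Real.cosh (B u - B v) - 1) else 0) := by
          simp only [sum_add_distrib]
      _ ≤ 8 * (q ^ 2 * Real.exp (q ^ 2 / 2)) * (harmonic ρ : ℝ) +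
          8 * (q ^ 2 * Real.exp (q ^ 2 / 2)) * (harmonic ρ : ℝ) := add_le_add hmonoY hmonoX
      _ = 16 * (q ^ 2 * Real.exp (q ^ 2 / 2)) * (harmonic ρ : ℝ) := by ring

end Literature.MathematicalPhysics.QuantumLattice
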